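import Summits.CriticalPhenomena.Ising3DConformalLimit.Theses.UnitLightCone
import HarnessLib

/-!
# Crux `UnitLightCone.LightConeRoundness` (stmt-CriticalPhenomena-17169) — negative-side support, II:
the lattice MIRROR symmetries are the load-bearing Ising input of the light-cone mechanism

cdisprove cycle 1, companion of `Negative/FalseWithoutIsingLimit.lean` (independent of it).  The crux's own line
(`Lines/birth.lean`, support `TwoPointLightConeRigidity`) derives roundness from the unit-cone representation H7 plus
what the Ising limit H2 supplies (`twoPointKernelOfLimit_proof`: window `1/2 ≤ Δ ≤ 1`, continuity, positivity,
homogeneity, nine lattice mirror symmetries).  Put back everything EXCEPT the mirrors and keep BOTH light cones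
H7, H8: the resulting `LightConeRoundnessWithoutMirrors` is false, conditionally on the classical Källén–Lehmann
representation of the ROUND kernel at one exponent `Δ₀ ∈ [1/2,1]` (`RoundKernelAxisConeKL Δ₀`; a 2-D Fourier–Bessel
identity, TRUE for every `Δ₀ ≥ 1/2`, not in Mathlib):
`lightConeRoundness_false_without_mirrors_of_roundKL : 1/2 ≤ Δ₀ → Δ₀ ≤ 1 → RoundKernelAxisConeKL Δ₀ → ¬ …`.
Witness: the ELLIPSOID family `S 2 (y,z) = Q(z-y)^(-Δ₀)`, `Q = 2x₀² + 2x₀x₁ + 2x₁² + 3x₂² = 3x_d² + x_{d'}² + 3x₂²`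
(`d = (e₀+e₁)/√2`): in each of the two frames the transverse form is `≼` the time coefficient `3`, so the round
measure pushed forward under a momentum CONTRACTION (`‖k'‖ ≤ ‖k‖`) and scaled by `3^(-Δ₀)` represents `Q^(-Δ₀)`
with support still in the forward cone, while `Q(e₀)^(-Δ₀) = 2^(-Δ₀) ≠ 3^(-Δ₀) = Q(e₂)^(-Δ₀)`, `e₂ = swap₀₂ e₀`.
The ellipsoid lacks exactly the quarter turn about `e₂` (a product of two lattice mirrors) used by the line.
-/

namespace Summit.CriticalPhenomena.Ising3DConformalLimit.Theorems.LightConeRoundness.Negative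

open Literature.Probability.LatticeModels MeasureTheory

/-- Classical input (TRUE; not in Mathlib, not formalised here): the ROUND kernel `(a² + b² + t²)^(-Δ)` has a
unit-cone Källén–Lehmann representation in the axis frame.  For `Δ = 1/2` this is the Poisson / Fourier–Bessel
identity `∫_{ℝ²} cos(k·w) e^{-|k| t} d²k / (2π|k|) = (|w|² + t²)^{-1/2}` (spectral measure `d²k/(2π|k|) ⊗ δ_{ω=|k|}`,
carried by the cone `ω = |k|`); for `Δ > 1/2` superpose the massive kernels `e^{-m|x|}/|x|`, weight `m^{2Δ-2} dm`
(`ω = √(k²+m²) ≥ |k|`).  Glimm–Jaffe 1987 §6.2 (free covariance); Stein–Weiss 1971 Ch. I Thm 1.14 (Poisson kernel). [cite: GlimmJaffe1987, §6.2] -/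
def RoundKernelAxisConeKL (Δ : ℝ) : Prop :=
  ∃ μ : Measure (EuclideanSpace ℝ (Fin 2) × ℝ), μ {p : EuclideanSpace ℝ (Fin 2) × ℝ | p.2 < ‖p.1‖} = 0 ∧
    (∀ t a b : ℝ, t ≠ 0 → (a ^ 2 + b ^ 2 + t ^ 2) ^ (-Δ) =
      ∫ p, Real.cos (p.1 0 * a + p.1 1 * b) * Real.exp (-(p.2 * |t|)) ∂μ)

/-- The crux with H1, H2 deleted and, of what H2 supplies through the tree theorem `twoPointKernelOfLimit_proof`,
everything EXCEPT the nine lattice mirror symmetries put back: the window `1/2 ≤ Δ ≤ 1` and continuity of the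
kernel off `0` (positivity is H4, homogeneity is H6).  FALSE modulo `RoundKernelAxisConeKL`:
`lightConeRoundness_false_without_mirrors_of_roundKL`. -/
def LightConeRoundnessWithoutMirrors : Prop :=
  ∀ (Δ : ℝ) (S : CorrFamily 3), 1 / 2 ≤ Δ → Δ ≤ 1 → (∀ n z, z ∉ NonCoincident 3 n → S n z = 0) →
    IsNondegenerateTwoPoint S → IsTranslationInvariant S → IsScaleCovariant Δ S →
    ContinuousOn (fun x : EuclideanSpace ℝ (Fin 3) => S 2 ![0, x]) {0}ᶜ →
    (∃ μ : Measure (EuclideanSpace ℝ (Fin 2) × ℝ), μ {p : EuclideanSpace ℝ (Fin 2) × ℝ | p.2 < ‖p.1‖} = 0 ∧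
      (∀ t a b : ℝ, t ≠ 0 → (fun x : EuclideanSpace ℝ (Fin 3) => S 2 ![0, x])
        (EuclideanSpace.single 0 a + EuclideanSpace.single 1 b + EuclideanSpace.single 2 t) =
        ∫ p, Real.cos (p.1 0 * a + p.1 1 * b) * Real.exp (-(p.2 * |t|)) ∂μ)) →
    (∃ μ : Measure (EuclideanSpace ℝ (Fin 2) × ℝ), μ {p : EuclideanSpace ℝ (Fin 2) × ℝ | p.2 < ‖p.1‖} = 0 ∧
      (∀ t u v : ℝ, t ≠ 0 → (fun x : EuclideanSpace ℝ (Fin 3) => S 2 ![0, x])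
        (EuclideanSpace.single 0 ((t + u) / Real.sqrt 2) + EuclideanSpace.single 1 ((t - u) / Real.sqrt 2) +
          EuclideanSpace.single 2 v) =
        ∫ p, Real.cos (p.1 0 * u + p.1 1 * v) * Real.exp (-(p.2 * |t|)) ∂μ)) →
    ∀ (R : EuclideanSpace ℝ (Fin 3) ≃ₗᵢ[ℝ] EuclideanSpace ℝ (Fin 3)) (x : EuclideanSpace ℝ (Fin 3)),
      S 2 ![0, R x] = S 2 ![0, x]

/-- The ellipsoidal quadratic form `Q(x) = 2x₀² + 2x₀x₁ + 2x₁² + 3x₂² = 3x_d² + x_{d'}² + 3x₂²`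
(`d = (e₀+e₁)/√2`, `d' = (e₀-e₁)/√2`): transverse stiffness `≼` the time coefficient `3` in BOTH frames `e₂`
and `d`, which is exactly the unit-cone condition after a linear change of the transverse momentum. -/
noncomputable def ellQ (x : EuclideanSpace ℝ (Fin 3)) : ℝ :=
  2 * x 0 ^ 2 + 2 * (x 0 * x 1) + 2 * x 1 ^ 2 + 3 * x 2 ^ 2

/-- The ellipsoid kernel `Q(x)^(-Δ)` (value `0` at the origin by `Real.zero_rpow`). -/
noncomputable def ellKernel (Δ : ℝ) (x : EuclideanSpace ℝ (Fin 3)) : ℝ :=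
  ellQ x ^ (-Δ)

/-- The ellipsoid family: `S 2 (y, z) = Q(z - y)^(-Δ)`, all other `S n = 0`. -/
noncomputable def ellFamily (Δ : ℝ) : CorrFamily 3
  | 2 => fun z => ellKernel Δ (z 1 - z 0)
  | _ => fun _ => 0

/-- The two-point entry of the ellipsoid family. -/
@[simp] theorem ellFamily_two (Δ : ℝ) (z : Fin 2 → EuclideanSpace ℝ (Fin 3)) :
    ellFamily Δ 2 z = ellKernel Δ (z 1 - z 0) := rfl

/-- Every entry of the ellipsoid family other than the two-point one vanishes. -/
theorem ellFamily_ne_two (Δ : ℝ) {n : ℕ} (hn : n ≠ 2) (z : Fin n → EuclideanSpace ℝ (Fin 3)) :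
    ellFamily Δ n z = 0 := by
  match n, hn with
  | 0, _ => rfl
  | 1, _ => rfl
  | 2, h => exact absurd rfl h
  | _ + 3, _ => rfl

/-- `Q` as a sum of squares. -/
theorem ellQ_eq (x : EuclideanSpace ℝ (Fin 3)) :
    ellQ x = x 0 ^ 2 + x 1 ^ 2 + (x 0 + x 1) ^ 2 + 3 * x 2 ^ 2 := by
  unfold ellQ; ring

/-- `Q ≥ 0`. -/
theorem ellQ_nonneg (x : EuclideanSpace ℝ (Fin 3)) : 0 ≤ ellQ x := by
  rw [ellQ_eq]; positivity

/-- `Q(0) = 0`. -/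
theorem ellQ_zero : ellQ 0 = 0 := by simp [ellQ]

/-- `Q > 0` off the origin (positive definiteness). -/
theorem ellQ_pos {x : EuclideanSpace ℝ (Fin 3)} (hx : x ≠ 0) : 0 < ellQ x := by
  rcases (ellQ_nonneg x).lt_or_eq with h | h
  · exact h
  · exfalso
    apply hx
    have hsum : x 0 ^ 2 + x 1 ^ 2 + (x 0 + x 1) ^ 2 + 3 * x 2 ^ 2 = 0 := by rw [← ellQ_eq]; exact h.symm
    have h0 : x 0 ^ 2 = 0 := by
      nlinarith [sq_nonneg (x 0), sq_nonneg (x 1), sq_nonneg (x 0 + x 1), sq_nonneg (x 2)]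
    have h1 : x 1 ^ 2 = 0 := by
      nlinarith [sq_nonneg (x 0), sq_nonneg (x 1), sq_nonneg (x 0 + x 1), sq_nonneg (x 2)]
    have h2 : x 2 ^ 2 = 0 := by
      nlinarith [sq_nonneg (x 0), sq_nonneg (x 1), sq_nonneg (x 0 + x 1), sq_nonneg (x 2)]
    have h0' : x 0 = 0 := (pow_eq_zero_iff two_ne_zero).mp h0
    have h1' : x 1 = 0 := (pow_eq_zero_iff two_ne_zero).mp h1
    have h2' : x 2 = 0 := (pow_eq_zero_iff two_ne_zero).mp h2
    ext i
    fin_cases i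
    · simpa using h0'
    · simpa using h1'
    · simpa using h2'

/-- `Q` is a quadratic form: `Q(c x) = c² Q(x)`. -/
theorem ellQ_smul (c : ℝ) (x : EuclideanSpace ℝ (Fin 3)) : ellQ (c • x) = c ^ 2 * ellQ x := by
  simp only [ellQ, PiLp.smul_apply, smul_eq_mul]; ring

/-- `Q` is continuous. -/
theorem continuous_ellQ : Continuous ellQ := by
  have h : ∀ i : Fin 3, Continuous fun x : EuclideanSpace ℝ (Fin 3) => x i :=
    fun i => PiLp.continuous_apply 2 _ i
  unfold ellQ
  exact (((continuous_const.mul ((h 0).pow 2)).add (continuous_const.mul ((h 0).mul (h 1)))).add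
    (continuous_const.mul ((h 1).pow 2))).add (continuous_const.mul ((h 2).pow 2))

/-- The ellipsoid kernel vanishes at the origin (`Δ ≠ 0`). -/
theorem ellKernel_zero {Δ : ℝ} (hΔ : Δ ≠ 0) : ellKernel Δ 0 = 0 := by
  rw [ellKernel, ellQ_zero, Real.zero_rpow (neg_ne_zero.mpr hΔ)]

/-- The ellipsoid kernel is positive off the origin. -/
theorem ellKernel_pos (Δ : ℝ) {x : EuclideanSpace ℝ (Fin 3)} (hx : x ≠ 0) : 0 < ellKernel Δ x :=
  Real.rpow_pos_of_pos (ellQ_pos hx) _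

/-- The ellipsoid kernel is homogeneous of degree `-2Δ`. -/
theorem ellKernel_smul (Δ : ℝ) {c : ℝ} (hc : 0 < c) (x : EuclideanSpace ℝ (Fin 3)) :
    ellKernel Δ (c • x) = c ^ (-(2:ℝ) * Δ) * ellKernel Δ x := by
  unfold ellKernel
  rw [ellQ_smul, Real.mul_rpow (sq_nonneg c) (ellQ_nonneg x)]
  congr 1
  rw [show -(2:ℝ) * Δ = 2 * (-Δ) by ring, Real.rpow_mul hc.le, Real.rpow_two]

/-- The ellipsoid kernel is continuous off the origin. -/
theorem continuousOn_ellKernel (Δ : ℝ) : ContinuousOn (ellKernel Δ) {0}ᶜ :=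
  continuous_ellQ.continuousOn.rpow_const fun _x hx => Or.inl (ellQ_pos hx).ne'

/-- H3 for the ellipsoid family (`Δ ≠ 0`). -/
theorem ellFamily_normalised {Δ : ℝ} (hΔ : Δ ≠ 0) : ∀ n z, z ∉ NonCoincident 3 n → ellFamily Δ n z = 0 := by
  intro n z hz
  by_cases hn : n = 2
  · subst hn
    rw [ellFamily_two]
    have h10 : z 1 - z 0 = 0 := by
      rw [mem_nonCoincident, Function.Injective] at hz
      push Not at hz
      obtain ⟨i, j, hij, hne⟩ := hz
      fin_cases i <;> fin_cases j
      · exact absurd rfl hne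
      · simpa [sub_eq_zero] using hij.symm
      · simpa [sub_eq_zero] using hij
      · exact absurd rfl hne
    rw [h10, ellKernel_zero hΔ]
  · exact ellFamily_ne_two Δ hn z

/-- H4 for the ellipsoid family. -/
theorem ellFamily_nondegenerate (Δ : ℝ) : IsNondegenerateTwoPoint (ellFamily Δ) := by
  intro z hz
  rw [mem_nonCoincident] at hz
  rw [ellFamily_two]
  refine ellKernel_pos Δ fun h => ?_
  have h10 : z 1 = z 0 := sub_eq_zero.mp h
  exact absurd (hz h10) (by decide)

/-- H5 for the ellipsoid family. -/
theorem ellFamily_translationInvariant (Δ : ℝ) : IsTranslationInvariant (ellFamily Δ) := by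
  intro n v z
  by_cases hn : n = 2
  · subst hn
    simp only [ellFamily_two, add_sub_add_right_eq_sub]
  · simp [ellFamily_ne_two Δ hn]

/-- H6 for the ellipsoid family: scale covariance with dimension `Δ`. -/
theorem ellFamily_scaleCovariant (Δ : ℝ) : IsScaleCovariant Δ (ellFamily Δ) := by
  intro n c hc z
  by_cases hn : n = 2
  · subst hn
    simp only [ellFamily_two, Nat.cast_ofNat]
    rw [← smul_sub, ellKernel_smul Δ hc]
  · simp [ellFamily_ne_two Δ hn]

/-- Continuity off `0` of the ellipsoid family's two-point kernel (= `ellKernel Δ`). -/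
theorem ellFamily_continuousOn (Δ : ℝ) :
    ContinuousOn (fun x : EuclideanSpace ℝ (Fin 3) => ellFamily Δ 2 ![0, x]) {0}ᶜ := by
  rw [show (fun x : EuclideanSpace ℝ (Fin 3) => ellFamily Δ 2 ![0, x]) = ellKernel Δ from funext fun x => by simp]
  exact continuousOn_ellKernel Δ

/-- The spacelike region `{ω < ‖k‖}` is measurable. -/
theorem measurableSet_spacelike :
    MeasurableSet {p : EuclideanSpace ℝ (Fin 2) × ℝ | p.2 < ‖p.1‖} :=
  measurableSet_lt continuous_snd.measurable continuous_fst.norm.measurable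

/-- Continuity of the transverse-momentum coordinates. -/
theorem continuous_momentum (i : Fin 2) : Continuous fun p : EuclideanSpace ℝ (Fin 2) × ℝ => p.1 i :=
  (PiLp.continuous_apply 2 _ i).comp continuous_fst

/-- Continuity of the Källén–Lehmann integrand. -/
theorem continuous_klIntegrand (a b t : ℝ) :
    Continuous fun p : EuclideanSpace ℝ (Fin 2) × ℝ => Real.cos (p.1 0 * a + p.1 1 * b) * Real.exp (-(p.2 * |t|)) :=
  (Real.continuous_cos.comp (((continuous_momentum 0).mul continuous_const).add
    ((continuous_momentum 1).mul continuous_const))).mul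
    (Real.continuous_exp.comp ((continuous_snd.mul continuous_const).neg))

/-- The transverse-momentum change of variables for the axis frame `e₂`:
`k ↦ (k₀/√2 + k₁/√6, k₀/√2 - k₁/√6)`, `ω ↦ ω` (operator norm `1`). -/
noncomputable def axisMap (p : EuclideanSpace ℝ (Fin 2) × ℝ) : EuclideanSpace ℝ (Fin 2) × ℝ :=
  ((p.1 0 * (Real.sqrt 2)⁻¹ + p.1 1 * (Real.sqrt 6)⁻¹) • EuclideanSpace.single 0 (1:ℝ) +
    (p.1 0 * (Real.sqrt 2)⁻¹ - p.1 1 * (Real.sqrt 6)⁻¹) • EuclideanSpace.single 1 (1:ℝ), p.2)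

/-- The transverse-momentum change of variables for the diagonal frame: `k ↦ (k₀/√3, k₁)`, `ω ↦ ω`. -/
noncomputable def diagMap (p : EuclideanSpace ℝ (Fin 2) × ℝ) : EuclideanSpace ℝ (Fin 2) × ℝ :=
  ((p.1 0 * (Real.sqrt 3)⁻¹) • EuclideanSpace.single 0 (1:ℝ) + p.1 1 • EuclideanSpace.single 1 (1:ℝ), p.2)

/-- First new momentum coordinate under `axisMap`. -/
@[simp] theorem axisMap_fst_zero (p : EuclideanSpace ℝ (Fin 2) × ℝ) :
    (axisMap p).1 0 = p.1 0 * (Real.sqrt 2)⁻¹ + p.1 1 * (Real.sqrt 6)⁻¹ := by simp [axisMap]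

/-- Second new momentum coordinate under `axisMap`. -/
@[simp] theorem axisMap_fst_one (p : EuclideanSpace ℝ (Fin 2) × ℝ) :
    (axisMap p).1 1 = p.1 0 * (Real.sqrt 2)⁻¹ - p.1 1 * (Real.sqrt 6)⁻¹ := by simp [axisMap]

/-- `axisMap` fixes the energy `ω`. -/
@[simp] theorem axisMap_snd (p : EuclideanSpace ℝ (Fin 2) × ℝ) : (axisMap p).2 = p.2 := rfl

/-- First new momentum coordinate under `diagMap`. -/
@[simp] theorem diagMap_fst_zero (p : EuclideanSpace ℝ (Fin 2) × ℝ) :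
    (diagMap p).1 0 = p.1 0 * (Real.sqrt 3)⁻¹ := by simp [diagMap]

/-- Second new momentum coordinate under `diagMap`. -/
@[simp] theorem diagMap_fst_one (p : EuclideanSpace ℝ (Fin 2) × ℝ) : (diagMap p).1 1 = p.1 1 := by simp [diagMap]

/-- `diagMap` fixes the energy `ω`. -/
@[simp] theorem diagMap_snd (p : EuclideanSpace ℝ (Fin 2) × ℝ) : (diagMap p).2 = p.2 := rfl

/-- `axisMap` is continuous. -/
theorem continuous_axisMap : Continuous axisMap := by
  unfold axisMap
  refine Continuous.prodMk ?_ continuous_snd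
  exact ((((continuous_momentum 0).mul continuous_const).add
    ((continuous_momentum 1).mul continuous_const)).smul continuous_const).add
    ((((continuous_momentum 0).mul continuous_const).sub
      ((continuous_momentum 1).mul continuous_const)).smul continuous_const)

/-- `diagMap` is continuous. -/
theorem continuous_diagMap : Continuous diagMap := by
  unfold diagMap
  refine Continuous.prodMk ?_ continuous_snd
  exact (((continuous_momentum 0).mul continuous_const).smul continuous_const).add
    ((continuous_momentum 1).smul continuous_const)

/-- `(1/√n)² = 1/n` for `0 ≤ n`. -/
theorem inv_sqrt_sq {n : ℝ} (hn : 0 ≤ n) : ((Real.sqrt n)⁻¹) ^ 2 = n⁻¹ := by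
  rw [inv_pow, Real.sq_sqrt hn]

/-- `axisMap` does not increase the transverse momentum: `‖k'‖² = k₀² + k₁²/3 ≤ ‖k‖²`. -/
theorem norm_axisMap_le (p : EuclideanSpace ℝ (Fin 2) × ℝ) : ‖(axisMap p).1‖ ≤ ‖p.1‖ := by
  rw [EuclideanSpace.norm_eq, EuclideanSpace.norm_eq]
  apply Real.sqrt_le_sqrt
  simp only [Fin.sum_univ_two, Real.norm_eq_abs, sq_abs, axisMap_fst_zero, axisMap_fst_one]
  have e : (p.1 0 * (Real.sqrt 2)⁻¹ + p.1 1 * (Real.sqrt 6)⁻¹) ^ 2 +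
      (p.1 0 * (Real.sqrt 2)⁻¹ - p.1 1 * (Real.sqrt 6)⁻¹) ^ 2 =
      2 * p.1 0 ^ 2 * ((Real.sqrt 2)⁻¹) ^ 2 + 2 * p.1 1 ^ 2 * ((Real.sqrt 6)⁻¹) ^ 2 := by ring
  rw [e, inv_sqrt_sq (by norm_num : (0:ℝ) ≤ 2), inv_sqrt_sq (by norm_num : (0:ℝ) ≤ 6)]
  nlinarith [sq_nonneg (p.1 1)]

/-- `diagMap` does not increase the transverse momentum: `‖k'‖² = k₀²/3 + k₁² ≤ ‖k‖²`. -/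
theorem norm_diagMap_le (p : EuclideanSpace ℝ (Fin 2) × ℝ) : ‖(diagMap p).1‖ ≤ ‖p.1‖ := by
  rw [EuclideanSpace.norm_eq, EuclideanSpace.norm_eq]
  apply Real.sqrt_le_sqrt
  simp only [Fin.sum_univ_two, Real.norm_eq_abs, sq_abs, diagMap_fst_zero, diagMap_fst_one]
  rw [mul_pow, inv_sqrt_sq (by norm_num : (0:ℝ) ≤ 3)]
  nlinarith [sq_nonneg (p.1 0)]

/-- Push-forward of a cone-supported measure under a momentum-contracting map is cone-supported. -/
theorem cone_of_map {μ : Measure (EuclideanSpace ℝ (Fin 2) × ℝ)}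
    (hμ : μ {p : EuclideanSpace ℝ (Fin 2) × ℝ | p.2 < ‖p.1‖} = 0)
    {φ : EuclideanSpace ℝ (Fin 2) × ℝ → EuclideanSpace ℝ (Fin 2) × ℝ} (hφ : Continuous φ)
    (hnorm : ∀ p, ‖(φ p).1‖ ≤ ‖p.1‖) (hsnd : ∀ p, (φ p).2 = p.2) (r : ENNReal) :
    (Measure.map φ (r • μ)) {p : EuclideanSpace ℝ (Fin 2) × ℝ | p.2 < ‖p.1‖} = 0 := by
  rw [Measure.map_apply hφ.measurable measurableSet_spacelike]
  have hsub : φ ⁻¹' {p : EuclideanSpace ℝ (Fin 2) × ℝ | p.2 < ‖p.1‖} ⊆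
      {p : EuclideanSpace ℝ (Fin 2) × ℝ | p.2 < ‖p.1‖} := fun p hp => by
    simp only [Set.mem_preimage, Set.mem_setOf_eq, hsnd] at hp
    exact lt_of_lt_of_le hp (hnorm p)
  refine measure_mono_null hsub ?_
  rw [Measure.smul_apply, hμ, smul_zero]

/-- Change of variables in the Källén–Lehmann integral. -/
theorem integral_map_smul {μ : Measure (EuclideanSpace ℝ (Fin 2) × ℝ)}
    {φ : EuclideanSpace ℝ (Fin 2) × ℝ → EuclideanSpace ℝ (Fin 2) × ℝ} (hφ : Continuous φ)
    {r : ℝ} (hr : 0 ≤ r) (a b t : ℝ) :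
    ∫ p, Real.cos (p.1 0 * a + p.1 1 * b) * Real.exp (-(p.2 * |t|)) ∂(Measure.map φ (ENNReal.ofReal r • μ)) =
      r * ∫ p, Real.cos ((φ p).1 0 * a + (φ p).1 1 * b) * Real.exp (-((φ p).2 * |t|)) ∂μ := by
  rw [integral_map hφ.measurable.aemeasurable (continuous_klIntegrand a b t).aestronglyMeasurable,
    integral_smul_measure, ENNReal.toReal_ofReal hr, smul_eq_mul]

/-- Value of `Q` at a point of the axis frame `e₂`. -/
theorem ellQ_axisPoint (a b t : ℝ) :
    ellQ (EuclideanSpace.single 0 a + EuclideanSpace.single 1 b + EuclideanSpace.single 2 t) =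
      2 * a ^ 2 + 2 * (a * b) + 2 * b ^ 2 + 3 * t ^ 2 := by
  simp [ellQ]

/-- Value of `Q` at a point of the diagonal frame. -/
theorem ellQ_diagPoint (t u v : ℝ) :
    ellQ (EuclideanSpace.single 0 ((t + u) / Real.sqrt 2) + EuclideanSpace.single 1 ((t - u) / Real.sqrt 2) +
      EuclideanSpace.single 2 v) = 3 * t ^ 2 + u ^ 2 + 3 * v ^ 2 := by
  simp only [ellQ_axisPoint, div_eq_mul_inv]
  have e : 2 * ((t + u) * (Real.sqrt 2)⁻¹) ^ 2 + 2 * ((t + u) * (Real.sqrt 2)⁻¹ * ((t - u) * (Real.sqrt 2)⁻¹)) +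
      2 * ((t - u) * (Real.sqrt 2)⁻¹) ^ 2 = (6 * t ^ 2 + 2 * u ^ 2) * ((Real.sqrt 2)⁻¹) ^ 2 := by ring
  rw [e, inv_sqrt_sq (by norm_num : (0:ℝ) ≤ 2)]; ring

/-- H7 for the ellipsoid family, from the round kernel's axis-frame representation: push the round measure
(scaled by `3^(-Δ)`) forward under `axisMap`. -/
theorem ellFamily_axisConeKL {Δ : ℝ} (hKL : RoundKernelAxisConeKL Δ) :
    ∃ μ : Measure (EuclideanSpace ℝ (Fin 2) × ℝ), μ {p : EuclideanSpace ℝ (Fin 2) × ℝ | p.2 < ‖p.1‖} = 0 ∧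
      (∀ t a b : ℝ, t ≠ 0 → (fun x : EuclideanSpace ℝ (Fin 3) => ellFamily Δ 2 ![0, x])
        (EuclideanSpace.single 0 a + EuclideanSpace.single 1 b + EuclideanSpace.single 2 t) =
        ∫ p, Real.cos (p.1 0 * a + p.1 1 * b) * Real.exp (-(p.2 * |t|)) ∂μ) := by
  obtain ⟨μ₀, hμ₀, hrep⟩ := hKL
  refine ⟨Measure.map axisMap (ENNReal.ofReal ((3:ℝ) ^ (-Δ)) • μ₀),
    cone_of_map hμ₀ continuous_axisMap norm_axisMap_le axisMap_snd _, fun t a b ht => ?_⟩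
  rw [integral_map_smul continuous_axisMap (Real.rpow_nonneg (by norm_num) _)]
  have hfun : (fun p : EuclideanSpace ℝ (Fin 2) × ℝ =>
      Real.cos ((axisMap p).1 0 * a + (axisMap p).1 1 * b) * Real.exp (-((axisMap p).2 * |t|))) =
      fun p => Real.cos (p.1 0 * ((Real.sqrt 2)⁻¹ * (a + b)) + p.1 1 * ((Real.sqrt 6)⁻¹ * (a - b))) *
        Real.exp (-(p.2 * |t|)) := by
    funext p
    rw [axisMap_fst_zero, axisMap_fst_one, axisMap_snd]
    congr 2
    ring
  rw [hfun, ← hrep t _ _ ht]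
  simp only [ellFamily_two, Matrix.cons_val_one, Matrix.cons_val_zero, sub_zero, ellKernel, ellQ_axisPoint]
  rw [← Real.mul_rpow (by norm_num) (by positivity)]
  congr 1
  rw [mul_pow, mul_pow, inv_sqrt_sq (by norm_num : (0:ℝ) ≤ 2), inv_sqrt_sq (by norm_num : (0:ℝ) ≤ 6)]
  ring

/-- H8 for the ellipsoid family, from the round kernel's axis-frame representation: push the round measure
(scaled by `3^(-Δ)`) forward under `diagMap`. -/
theorem ellFamily_diagConeKL {Δ : ℝ} (hKL : RoundKernelAxisConeKL Δ) :
    ∃ μ : Measure (EuclideanSpace ℝ (Fin 2) × ℝ), μ {p : EuclideanSpace ℝ (Fin 2) × ℝ | p.2 < ‖p.1‖} = 0 ∧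
      (∀ t u v : ℝ, t ≠ 0 → (fun x : EuclideanSpace ℝ (Fin 3) => ellFamily Δ 2 ![0, x])
        (EuclideanSpace.single 0 ((t + u) / Real.sqrt 2) + EuclideanSpace.single 1 ((t - u) / Real.sqrt 2) +
          EuclideanSpace.single 2 v) =
        ∫ p, Real.cos (p.1 0 * u + p.1 1 * v) * Real.exp (-(p.2 * |t|)) ∂μ) := by
  obtain ⟨μ₀, hμ₀, hrep⟩ := hKL
  refine ⟨Measure.map diagMap (ENNReal.ofReal ((3:ℝ) ^ (-Δ)) • μ₀),
    cone_of_map hμ₀ continuous_diagMap norm_diagMap_le diagMap_snd _, fun t u v ht => ?_⟩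
  rw [integral_map_smul continuous_diagMap (Real.rpow_nonneg (by norm_num) _)]
  have hfun : (fun p : EuclideanSpace ℝ (Fin 2) × ℝ =>
      Real.cos ((diagMap p).1 0 * u + (diagMap p).1 1 * v) * Real.exp (-((diagMap p).2 * |t|))) =
      fun p => Real.cos (p.1 0 * ((Real.sqrt 3)⁻¹ * u) + p.1 1 * v) * Real.exp (-(p.2 * |t|)) := by
    funext p
    rw [diagMap_fst_zero, diagMap_fst_one, diagMap_snd]
    congr 2
    ring
  rw [hfun, ← hrep t _ _ ht]
  simp only [ellFamily_two, Matrix.cons_val_one, Matrix.cons_val_zero, sub_zero, ellKernel, ellQ_diagPoint]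
  rw [← Real.mul_rpow (by norm_num) (by positivity)]
  congr 1
  rw [mul_pow, inv_sqrt_sq (by norm_num : (0:ℝ) ≤ 3)]
  ring

/-- **The lattice mirror symmetries are load-bearing** (conditional on the classical representation
`RoundKernelAxisConeKL Δ₀` of the round kernel at one exponent `Δ₀ ∈ [1/2, 1]`): the ellipsoid family at `Δ₀`
satisfies the window, H3–H6, continuity off `0` and BOTH unit-cone representations H7, H8, and its kernel takes
the values `2^(-Δ₀) ≠ 3^(-Δ₀)` at `e₀` and `e₂ = swap₀₂ e₀`. -/
theorem lightConeRoundness_false_without_mirrors_of_roundKL {Δ₀ : ℝ} (h₁ : 1 / 2 ≤ Δ₀) (h₂ : Δ₀ ≤ 1)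
    (hKL : RoundKernelAxisConeKL Δ₀) : ¬ LightConeRoundnessWithoutMirrors := by
  intro h
  have hΔ0 : Δ₀ ≠ 0 := by intro h0; rw [h0] at h₁; norm_num at h₁
  have key := h Δ₀ (ellFamily Δ₀) h₁ h₂ (ellFamily_normalised hΔ0) (ellFamily_nondegenerate Δ₀)
    (ellFamily_translationInvariant Δ₀) (ellFamily_scaleCovariant Δ₀) (ellFamily_continuousOn Δ₀)
    (ellFamily_axisConeKL hKL) (ellFamily_diagConeKL hKL)
    (LinearIsometryEquiv.piLpCongrLeft 2 ℝ ℝ (Equiv.swap (0 : Fin 3) 2)) (EuclideanSpace.single 0 1)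
  simp only [ellFamily_two, Matrix.cons_val_one, Matrix.cons_val_zero, sub_zero,
    LinearIsometryEquiv.piLpCongrLeft_single, Equiv.swap_apply_left, ellKernel] at key
  have hQ2 : ellQ (EuclideanSpace.single 2 (1:ℝ)) = 3 := by simp [ellQ]
  have hQ0 : ellQ (EuclideanSpace.single 0 (1:ℝ)) = 2 := by simp [ellQ]
  rw [hQ2, hQ0] at key
  have hlt : (3:ℝ) ^ (-Δ₀) < 2 ^ (-Δ₀) :=
    Real.rpow_lt_rpow_of_neg (by norm_num) (by norm_num) (by linarith)
  exact hlt.ne key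

end Summit.CriticalPhenomena.Ising3DConformalLimit.Theorems.LightConeRoundness.Negative
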